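import Literature.MathematicalPhysics.QuantumFieldTheory.Balaban1983to89.B9DirSupHolderAtPins
import Literature.MathematicalPhysics.QuantumFieldTheory.Balaban1983to89.B9Thm312WholeDir
import Literature.MathematicalPhysics.QuantumFieldTheory.Balaban1983to89.B9GeoLemma21KLevelV1

/-!
# `Balaban1983to89.B9Thm33G0ProbeYFromDirAtPins` — [B9] (3.45) p. 398 with the BUNDLED derivative ∇_U on the left, at node00-def-Y's pins: THE
# Φ^Y-PROBE OF ∇_U∘G₀∘∇*_{U,μ} OUT OF A BLOCK-NORM SOURCE IS THE FAMILY OF THE Φ^X-PROBES OF ∇_{U,ν}∘G₀∘∇*_{U,μ} — the reverse slice relabelling through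
# n06-d's probes, for BLOCK-NORM (Hölder) sources (the `h45Y` input of dag-n06-l's `pYDH_of_h45Y`)

T. Bałaban, *Propagators for lattice gauge theories in a background field*, Commun. Math. Phys. **99** (1985) 389–434
[`Balaban1985BackgroundPropagators`, "B9"]; [4] = T. Bałaban, *Propagators and renormalization transformations for lattice gauge
theories. II*, Commun. Math. Phys. **96** (1984) 223–250 [`Balaban1984PropagatorsII`].

statement-level skeleton of published theorems with citation tags; proofs where landed; nothing here is a claim about the Yang–Mills
mass gap

THE PRINTED LOCI.  (3.39)–(3.40) p. 397: the sup and Hölder norms of vector functions *"max_{μ,ν} sup_{x,x′}"* — they run over the direction index, so a bound for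
every component ∇_{U,ν} IS the bound for ∇_U; (3.45) p. 398: *"‖ζ∇_UG(U)∇\*_Uλ‖_β ≦ B′₀(ε,β)(Lʲη)^{−β}(…)e^{−δ₀d(y,y′)}(‖λ‖_{β+ε} + |λ|)"*; Theorem 3.3 p. 399 (G₀ =
G(U) satisfies (3.42)–(3.47)); [4] (2.51) p. 232.

THE POINT (cell `pub-ymgap`, node N06, width seat w6, W-c probe lane; the hand dag-n06-l g18 left open in its INTENT-2, pub-ymgap bus 2026-08-28 08:58Z: *«`pYDH_of_h45Y` —
a directional Φ^Y-(3.45) member stated as hypothesis — the Y-probe relabelling is n06-w5∕w6's lane»*).  The N06 certificate DERIVES Theorem 3.3 for G₀ in the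
direction-indexed species `B9Thm312WholeDir.Thm33G0Dir (𝔬12 x) (𝔭A x) (𝔡A x).Dd (𝔡A x).Dsd 1 (H x) (bHXA x) …` (`…N06G0LayerFromThm310AtPinsE.g0_layer_of_thm310_coreB`),
whose (3.45) field `h45m (ν, μ) ε β` reads the X-probe of the COMPONENT ∇_{U,ν}: `Φ^X_β ∘ (∇_{U,ν} ∘ (G₀ ∘ ∇\*_{U,μ}))` out of `bHXA x (β + ε)`.  The Hölder-source letter
`Letters313HZ.pYDH` (Φ^Y_β∘∇_U∘G₀∘D_U) needs, after n06-l's decomposition `D_U = Σ_μ ∇\*_{U,μ}∘J_μ`, the member with the BUNDLED ∇_U on the left and the Y-probes: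
`h45Y μ ε β : HasMaj (bHX (β+ε)) (ofBlocks 𝔭.blkPY) (𝔭.ΦY U β ∘ₗ (𝔬.D U ∘ₗ (𝔬.G0 U ∘ₗ Dds U μ))) (Bi2 ε β·(Lʲη)^{−β}·e^{−δ₀d})`.  At the pins this is pure bookkeeping:
`Φ^Y = Φ^X = probeK b g w w₀` on ONE probe lattice anchored slot-blind (`blkPY = blkPX = blkPK bP`; n06-d `holderProbesK`, n06-w6 g0 `holderProbesKA`), `𝔬.D U = DcoK =
coordOpK b (fun ν => ∇_{U,ν})` is the slice-DIAGONAL family of the direction letters `Dd U ν = coordOpK b (fun _ => ∇_{U,ν})`, and every probe of slot λ reads ONLY the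
slice λ of its argument (n06-w5 `B9DirSupHolderAtPins.probeK_eq_of_slice_eq`), on which the diagonal family and the constant family at λ AGREE (same input — no slot
swap, unlike the forward relabelling `hasMajorantHom_probe_constSlice_of_family`).  Hence:
* §1 ★★ `hasMaj_probe_family_of_constSlices` — for ANY source block norm `b₁`, any right factor `M`, any slice family `F` and any kernel `K ≥ 0`: if every
  `probeK ∘ₗ coordOpK b (fun _ => F λ) ∘ₗ M` has the majorant `K` into the sharp probe blocks, so does `probeK ∘ₗ coordOpK b F ∘ₗ M` — SAME kernel, no |D| factor
  (each probe is ONE of the constant-slice probes); `coordOpK_slice_eq_constSlice` is the pointwise identity;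
* §2 ★★ `h45Y_of_pins` — at the pins (`hΦX hΦY hPX hPY hD hDd`), from the directional members `∀ ν, HasMaj bX (ofBlocks 𝔭.blkPX) (𝔭.ΦX U β ∘ₗ (Dd ν ∘ₗ (𝔬.G0 U ∘ₗ
  Dds μ))) K` (the shape of `Thm33G0Dir.h45m (ν, μ) ε β`; ALSO of `h44m` read through probes, and of any kernel) to the bundled Y-member with the same `K`;
* §3 ★★ `h45Y_of_thm33G0Dir_pins` — every member `x`, every configuration `U` (NO regularity needed: relabelling only), from `Thm33G0Dir 𝔬 𝔭 Dd Dds R₀ H₀ bHX B₀ Bh Bi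
  Bi2 δ₀ U` at the certificate's pins (`h𝔭A`-shape probe letters, `hDco12`∕`hDcoA`, `h𝔡Ad`): `∀ μ ε β, 0 < ε → ε ≤ 1 → 0 ≤ β → β < 1 → HasMaj (bHX (β + ε)) (ofBlocks
  𝔭.blkPY) (𝔭.ΦY U β ∘ₗ (𝔬.D U ∘ₗ (𝔬.G0 U ∘ₗ Dds U μ))) (Bi2 ε β·(Lʲη)^{−β}·e^{−δ₀d})`.

HONEST SCOPE.  Relabelling algebra over n06-d's `coordOpK ∕ probeK`; NO estimate of [B9] asserted (the majorants are the schema's own hypotheses ∕ the certificate's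
derived `Thm33G0Dir`); COUNT-NEUTRAL; N06 is NOT discharged; one finite lattice at a time; nothing continuum, nothing about the mass gap ∕ Clay.  Cell `pub-ymgap`
(HUMAN RULING D-0062 ∕ D-0154), Track A node N06 [B9], width seat `pub-ymgap-dag-n06-w6` (g0′), 2026-08-28.  NEW file; nothing landed is modified.
-/

noncomputable section

namespace Literature.MathematicalPhysics.QuantumFieldTheory.Balaban1983to89.B9Thm33G0ProbeYFromDirAtPins

open B6KLevelCensusIndexV1 (KIdx)
open B11SectG (BlockNorm HasMaj)
open B9Thm34Ext (toB6)
open B9Thm37AllNormsInstances (abs_apply_le_ofBlocks_loc)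
open B9Thm312Whole (Ops)
open B9Thm312WholeDir (Thm33G0Dir)
open B9RWSums343Holder (HolderProbes)
open B9GeoNormsKLevelV1 (geo9K)
open B9CoReadingCoords (assembleK coordOpK coordOpK_apply XBK blkBK DcoK cdBₗ cdsBₗ)
open B9CoReadingCoordsHolder (PK blkPK probeK)
open B9DirSupHolderAtPins (probeK_eq_of_slice_eq)
open Node00

variable {d ℓ : ℕ} {hd : 1 ≤ d + 1} {hL : Odd (ℓ + 1) ∧ 1 < ℓ + 1} {b₀ b₁ : ℝ}

/-! ## §1 A probe is one of the constant-slice probes: majorants of the slice family from its constant slices, block-norm sources -/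

section Relabel

variable {𝔸 : Type} [NormedRing 𝔸] [NormedAlgebra ℂ 𝔸]
variable {κ : Type} [Fintype κ]
variable {S D : Type} [Fintype S] [Fintype D] (b : Module.Basis κ ℝ 𝔸)

omit [Fintype S] [Fintype D] in
/-- On the slice `λ`, the coordinate model of a direction family `F` and the constant family at `F λ` agree pointwise, on the SAME input.
[cite: Balaban1985BackgroundPropagators, (3.39) p.397, dictionary] -/
theorem coordOpK_slice_eq_constSlice (F : D → (S → 𝔸) →ₗ[ℝ] (S → 𝔸)) (f : S × D × κ × κ → ℝ) (lam : D) (z : S) (a c' : κ) :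
    coordOpK b F f (z, lam, a, c') = coordOpK b (fun _ : D => F lam) f (z, lam, a, c') := by
  simp only [coordOpK_apply]

/-- ★★ **THE SLICE FAMILY FROM ITS CONSTANT SLICES, THROUGH THE PROBES, FOR BLOCK-NORM SOURCES**: over probe anchors `blkPK sP` and the probe map `Φ = probeK b g w w₀`
(pair ∕ transported-point ∕ point probes, each reading ONE slice of its argument), if for every slot `λ` the operator `Φ ∘ₗ coordOpK b (fun _ => F λ) ∘ₗ M` has the
majorant `K ≥ 0` from a block norm `b₁` into the sharp probe blocks, then so does `Φ ∘ₗ coordOpK b F ∘ₗ M` with the SAME `K` — the probe at slot `λ` of the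
latter equals the probe of the former at `λ` (`probeK_eq_of_slice_eq`, same input).  Print: the norms (3.39)–(3.40) are maxima over the direction index.
[cite: Balaban1985BackgroundPropagators, (3.39)–(3.40) p.397 + (3.45) p.398; Balaban1984PropagatorsII, (2.51) p.232] -/
theorem hasMaj_probe_family_of_constSlices {G : B6.Geometry} (sP : S → G.Site) (g : S → S → 𝔸ˣ) (w : S → S → ℝ) (w₀ : S → ℝ)
    (F : D → (S → 𝔸) →ₗ[ℝ] (S → 𝔸)) {F₁ : Type} [AddCommGroup F₁] [Module ℝ F₁] {b₁ : BlockNorm G F₁}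
    {M : F₁ →ₗ[ℝ] (S × D × κ × κ → ℝ)} {K : G.Site → G.Site → ℝ} (hK : ∀ a c, 0 ≤ K a c)
    (h : ∀ lam : D, HasMaj b₁ (BlockNorm.ofBlocks G (blkPK (D := D) (κ := κ) sP))
      (probeK b g w w₀ ∘ₗ coordOpK b (fun _ : D => F lam) ∘ₗ M) K) :
    HasMaj b₁ (BlockNorm.ofBlocks G (blkPK (D := D) (κ := κ) sP)) (probeK b g w w₀ ∘ₗ coordOpK b F ∘ₗ M) K := by
  classical
  intro y' μ hμ y
  have hB : 0 ≤ K y y' * b₁.loc y' μ := mul_nonneg (hK y y') (b₁.loc_nonneg _ _)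
  -- the λ-slice of the family's output is the λ-slice of the constant family's output, same input
  have hV : ∀ lam : D, ∀ z a c', (coordOpK b F (M μ)) (z, lam, a, c') = (coordOpK b (fun _ : D => F lam) (M μ)) (z, lam, a, c') :=
    fun lam z a c' => coordOpK_slice_eq_constSlice b F (M μ) lam z a c'
  -- the constant-slice majorant, evaluated
  have hc : ∀ lam : D, (BlockNorm.ofBlocks G (blkPK (D := D) (κ := κ) sP)).loc y
      (probeK b g w w₀ (coordOpK b (fun _ : D => F lam) (M μ))) ≤ K y y' * b₁.loc y' μ := fun lam => by
    have h' := h lam y' μ hμ y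
    simp only [LinearMap.comp_apply] at h'
    exact h'
  show (⨆ q : PK S D κ, if blkPK (D := D) (κ := κ) sP q = y then |((probeK b g w w₀ ∘ₗ coordOpK b F ∘ₗ M) μ) q| else 0) ≤
    K y y' * b₁.loc y' μ
  by_cases hX : Nonempty (PK S D κ)
  · refine ciSup_le fun q => ?_
    split_ifs with hqy
    · simp only [LinearMap.comp_apply]
      rcases q with ⟨xx, lam, c, c'⟩ | ⟨xx, lam, c, c'⟩ | ⟨x, lam, c, c'⟩
      · rw [(probeK_eq_of_slice_eq b g w w₀ (hV lam) xx xx.1 c c').1]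
        exact (abs_apply_le_ofBlocks_loc (G := G) (blkPK (D := D) (κ := κ) sP) y _ (Sum.inl (xx, lam, c, c')) hqy).trans (hc lam)
      · rw [(probeK_eq_of_slice_eq b g w w₀ (hV lam) xx xx.1 c c').2.1]
        exact (abs_apply_le_ofBlocks_loc (G := G) (blkPK (D := D) (κ := κ) sP) y _ (Sum.inr (Sum.inl (xx, lam, c, c'))) hqy).trans
          (hc lam)
      · rw [(probeK_eq_of_slice_eq b g w w₀ (hV lam) (x, x) x c c').2.2]
        exact (abs_apply_le_ofBlocks_loc (G := G) (blkPK (D := D) (κ := κ) sP) y _ (Sum.inr (Sum.inr (x, lam, c, c'))) hqy).trans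
          (hc lam)
    · exact hB
  · rw [not_nonempty_iff] at hX
    simp only [iSup_of_empty', Real.sSup_empty]
    exact hB

end Relabel

/-! ## §2 The bundled Φ^Y-member from the directional Φ^X-members at the pins -/

section Pins

variable {𝔸 : Type} [NormedRing 𝔸] [NormedAlgebra ℂ 𝔸] [CompleteSpace 𝔸]
variable {κ : Type} [Fintype κ]
variable (i : KIdx d ℓ hd hL b₀ b₁) (b : Module.Basis κ ℝ 𝔸) (B : B9.Backgrounds) (cfg : B.Cfg → CfgY 𝔸 i)
variable [Fintype (geo9K i).Site]

/-- ★★ **Φ^Y∘(∇_U∘G₀∘∇\*_{U,μ}) FROM THE Φ^X∘(∇_{U,ν}∘G₀∘∇\*_{U,μ}), ν ∈ D, AT THE PINS** — for probe letters with `ΦX U β = ΦY U β = probeK b g w w₀` and `blkPX = blkPY =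
blkPK bP` (n06-d `holderProbesK`, n06-w6 `holderProbesKA`), `𝔬.D U = DcoK` (slice-diagonal ∇_U) and the direction letters `Dd = fun ν => coordOpK b (fun _ => ∇_{U,ν})`:
a majorant `K ≥ 0` from any block norm `bX` shared by all directional members IS a majorant of the bundled Y-member (the shape `Thm33G0Dir.h45m (·, μ) ε β ↦ h45Y μ ε
β`; `G0`, `Dds μ` arbitrary). [cite: Balaban1985BackgroundPropagators, (3.45) p.398 + (3.39)–(3.40) p.397 + (3.42) p.397; Balaban1984PropagatorsII, (2.51) p.232] -/
theorem h45Y_of_pins {Z W : Type} (𝔬 : Ops (geo9K i) B (XBK κ i) (XBK κ i) Z W)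
    (𝔭 : HolderProbes (geo9K i) B (XBK κ i) (XBK κ i) (PK (FBondY i) (Fin (d + 1)) κ) (PK (FBondY i) (Fin (d + 1)) κ))
    {bP : FBondY i → IBondY i} (g : FBondY i → FBondY i → 𝔸ˣ) (w : FBondY i → FBondY i → ℝ) (w₀ : FBondY i → ℝ) {U₁ : B.Cfg} {βH : ℝ}
    (hΦX : 𝔭.ΦX U₁ βH = probeK b g w w₀) (hΦY : 𝔭.ΦY U₁ βH = probeK b g w w₀)
    (hPX : 𝔭.blkPX = blkPK bP) (hPY : 𝔭.blkPY = blkPK bP)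
    (hD : 𝔬.D U₁ = DcoK i b B cfg U₁)
    {Dd : Fin (d + 1) → Module.End ℝ (XBK κ i → ℝ)} (hDd : Dd = fun ν => coordOpK b (fun _ : Fin (d + 1) => cdBₗ i (cfg U₁) ν))
    {G0 Ddsμ : Module.End ℝ (XBK κ i → ℝ)} {R₀ : ℝ} {H₀ : Prop} {bX : BlockNorm (toB6 (geo9K i) R₀ H₀) (XBK κ i → ℝ)}
    {K : (geo9K i).Site → (geo9K i).Site → ℝ} (hK : ∀ a c, 0 ≤ K a c)
    (h : ∀ ν, HasMaj bX (BlockNorm.ofBlocks (toB6 (geo9K i) R₀ H₀) 𝔭.blkPX) (𝔭.ΦX U₁ βH ∘ₗ (Dd ν ∘ₗ (G0 ∘ₗ Ddsμ))) K) :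
    HasMaj bX (BlockNorm.ofBlocks (toB6 (geo9K i) R₀ H₀) 𝔭.blkPY) (𝔭.ΦY U₁ βH ∘ₗ (𝔬.D U₁ ∘ₗ (G0 ∘ₗ Ddsμ))) K := by
  rw [hPY, hΦY, hD]
  rw [hPX, hΦX, hDd] at h
  change HasMaj bX (BlockNorm.ofBlocks (toB6 (geo9K i) R₀ H₀) (blkPK (D := Fin (d + 1)) (κ := κ) bP))
    (probeK b g w w₀ ∘ₗ coordOpK b (fun ν : Fin (d + 1) => cdBₗ i (cfg U₁) ν) ∘ₗ (G0 ∘ₗ Ddsμ)) K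
  exact hasMaj_probe_family_of_constSlices b (G := toB6 (geo9K i) R₀ H₀) bP g w w₀ (fun ν : Fin (d + 1) => cdBₗ i (cfg U₁) ν) hK h

end Pins

/-! ## §3 From the derived `Thm33G0Dir` at node00-def-Y's members, every configuration -/

section Members

open scoped Matrix.Norms.L2Operator
open B7Prop2SpecialUnitary (specialUnitaryUnits)
open B9PinMembersKLevelV1 (MemberY geo9Y bg9Y)
open B9CoReadingCoordsTranspose (TrIdx trBasis)

variable {Mstar : ℕ} {N : ℕ}
variable [∀ x : MemberY d ℓ hd hL b₀ b₁ Mstar, Fintype (geo9Y x).Site]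

/-- ★★ **THE BUNDLED Φ^Y-(3.45) MEMBERS `h45Y μ ε β` OF THEOREM 3.3 FOR G₀ AT THE CERTIFICATE'S PINS, EVERY MEMBER, EVERY CONFIGURATION** — from the derived schema
`Thm33G0Dir 𝔬 𝔭 Dd Dds R₀ H₀ bHX B₀ Bh Bi Bi2 δ₀ U` (its `h45m`), for probe letters of `h𝔭A`-shape (`ΦX U β = ΦY U β = probeK (trBasis N) gU (w β) (w₀ β)`, anchors `blkPK bP`
on both sides — `holderProbesK` ∕ `holderProbesKA` read off by `rfl`), `𝔬.D U = DcoK …` (`hDco12` ∕ `hDcoA`) and `Dd U = fun ν => coordOpK (trBasis N) (fun _ => cdBₗ … ν)`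
(`h𝔡Ad`); `Bi2 ≥ 0` on the range used.  Output: `∀ μ ε β, 0 < ε → ε ≤ 1 → 0 ≤ β → β < 1 → HasMaj (bHX (β + ε)) (ofBlocks 𝔭.blkPY) (𝔭.ΦY U β ∘ₗ (𝔬.D U ∘ₗ (𝔬.G0 U ∘ₗ
Dds U μ))) (Bi2 ε β·(Lʲη)^{−β}·e^{−δ₀d})` — the `h45Y` hypothesis of dag-n06-l's `pYDH_of_h45Y`.
[cite: Balaban1985BackgroundPropagators, Thm 3.3 (3.45) p.398 + (3.39)–(3.40) p.397; Balaban1984PropagatorsII, (2.51) p.232] -/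
theorem h45Y_of_thm33G0Dir_pins (x : MemberY d ℓ hd hL b₀ b₁ Mstar) {Z W : Type}
    (𝔬 : Ops (geo9Y x) (bg9Y (Matrix (Fin N) (Fin N) ℂ) (specialUnitaryUnits (Fin N)) x) (XBK (TrIdx N) x.toKIdx) (XBK (TrIdx N) x.toKIdx) Z W)
    (𝔭 : HolderProbes (geo9Y x) (bg9Y (Matrix (Fin N) (Fin N) ℂ) (specialUnitaryUnits (Fin N)) x) (XBK (TrIdx N) x.toKIdx) (XBK (TrIdx N) x.toKIdx)
      (PK (FBondY x.toKIdx) (Fin (d + 1)) (TrIdx N)) (PK (FBondY x.toKIdx) (Fin (d + 1)) (TrIdx N)))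
    {Dd Dds : (bg9Y (Matrix (Fin N) (Fin N) ℂ) (specialUnitaryUnits (Fin N)) x).Cfg → Fin (d + 1) → Module.End ℝ (XBK (TrIdx N) x.toKIdx → ℝ)}
    {R₀ : ℝ} {H₀ : Prop} {bHX : ℝ → BlockNorm (toB6 (geo9Y x) R₀ H₀) (XBK (TrIdx N) x.toKIdx → ℝ)} {B₀ δ₀ : ℝ} {Bh Bi : ℝ → ℝ} {Bi2 : ℝ → ℝ → ℝ}
    {U : (bg9Y (Matrix (Fin N) (Fin N) ℂ) (specialUnitaryUnits (Fin N)) x).Cfg}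
    (h33 : Thm33G0Dir 𝔬 𝔭 Dd Dds R₀ H₀ bHX B₀ Bh Bi Bi2 δ₀ U)
    {bP : FBondY x.toKIdx → IBondY x.toKIdx} (gU : FBondY x.toKIdx → FBondY x.toKIdx → (Matrix (Fin N) (Fin N) ℂ)ˣ)
    (w : ℝ → FBondY x.toKIdx → FBondY x.toKIdx → ℝ) (w₀ : ℝ → FBondY x.toKIdx → ℝ)
    (hΦX : ∀ β, 𝔭.ΦX U β = probeK (trBasis N) gU (w β) (w₀ β)) (hΦY : ∀ β, 𝔭.ΦY U β = probeK (trBasis N) gU (w β) (w₀ β))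
    (hPX : 𝔭.blkPX = blkPK bP) (hPY : 𝔭.blkPY = blkPK bP)
    (hD : 𝔬.D U = DcoK x.toKIdx (trBasis N) (bg9Y (Matrix (Fin N) (Fin N) ℂ) (specialUnitaryUnits (Fin N)) x) (fun U => U) U)
    (hDd : Dd U = fun ν => coordOpK (trBasis N) (fun _ : Fin (d + 1) => cdBₗ x.toKIdx U ν))
    (hBi2 : ∀ e b', 0 < e → e ≤ 1 → 0 ≤ b' → b' < 1 → 0 ≤ Bi2 e b') :
    ∀ (μ : Fin (d + 1)) (ε β : ℝ), 0 < ε → ε ≤ 1 → 0 ≤ β → β < 1 →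
      HasMaj (bHX (β + ε)) (BlockNorm.ofBlocks (toB6 (geo9Y x) R₀ H₀) 𝔭.blkPY) (𝔭.ΦY U β ∘ₗ (𝔬.D U ∘ₗ (𝔬.G0 U ∘ₗ Dds U μ)))
        (fun a c => Bi2 ε β * (geo9Y x).len a ^ (-β) * Real.exp (-(δ₀ * (geo9Y x).dist a c))) := by
  letI : Fintype (geo9K x.toKIdx).Site := (inferInstance : Fintype (geo9Y x).Site)
  intro μ ε β hε0 hε1 hβ0 hβ1
  have hK : ∀ a c : (geo9Y x).Site, 0 ≤ Bi2 ε β * (geo9Y x).len a ^ (-β) * Real.exp (-(δ₀ * (geo9Y x).dist a c)) := fun a c =>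
    mul_nonneg (mul_nonneg (hBi2 ε β hε0 hε1 hβ0 hβ1) (Real.rpow_nonneg (B9GeoLemma21KLevelV1.geo9Y_len_pos x a).le _))
      (Real.exp_nonneg _)
  exact h45Y_of_pins x.toKIdx (trBasis N) (bg9Y (Matrix (Fin N) (Fin N) ℂ) (specialUnitaryUnits (Fin N)) x) (fun U => U) 𝔬 𝔭 gU (w β) (w₀ β)
    (hΦX β) (hΦY β) hPX hPY hD hDd hK (fun ν => h33.h45m (ν, μ) ε β hε0 hε1 hβ0 hβ1)

end Members

end Literature.MathematicalPhysics.QuantumFieldTheory.Balaban1983to89.B9Thm33G0ProbeYFromDirAtPins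

end
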